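import Mathlib.Data.Nat.Bitwise
import Mathlib.Data.Finset.Max
import Mathlib.Data.Fintype.Pi
import Mathlib.Data.Fintype.BigOperators
import Mathlib.Algebra.BigOperators.Ring.Finset
import Mathlib.Algebra.Order.BigOperators.Group.Finset
import HarnessLib

/-!
# Valiant's depth-reduction lemma (Valiant 1977), as printed and proved in Chatterjee–Kumar–She–Volk 2022, Lemma 16

P. Chatterjee, M. Kumar, A. She, B. L. Volk, *Quadratic lower bounds for algebraic branching programs
and formulas*, comput. complex. **31** (2022) 8 (arXiv:1911.11793), §4, Lemma 16 (TeX lines 570–581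
of the arXiv source), "a famous lemma of Valiant [Valiant77], simplifying and improving an earlier
result of Erdős, Graham and Szemerédi", with the proof printed there; L. G. Valiant,
*Graph-theoretic arguments in low-level complexity*, MFCS 1977, LNCS 53, 162–176 [Valiant1977].

**Lemma 16** ([Valiant77], as printed): "Let `G` be a directed acyclic graph with `m` edges and
depth `d ≥ √n`. Then, there exists a set `E'` of at most `4m / log n` edges such that removing `E'`
from `G` results in a graph of depth at most `d/2`."

**Printed proof** (the statement actually established, which we formalise): "A *valid labeling* of
a directed graph `G = (V,E)` is a function `f : V → {0,…,N−1}` such that whenever `(u,v)` is an edge,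
`f(u) < f(v)`. Clearly if `G` had depth `d` then there is a valid labeling with image `{0,…,d−1}` by
labeling each vertex by its depth. Conversely, if there is a valid labeling with image `{0,…,N−1}`
then `depth(G) ≤ N`. Let `f` be a valid labeling of `G` with image `{0,…,d'−1}` [`d' = 2^k`] and for
`i ∈ [k]` let `E_i` be the set of edges such that the most significant bit in which the binary
encoding of the labels of their endpoints differ is `i`. If `E_i` is removed, we can obtain a valid
relabeling of the graph with image `{0,…,d'/2−1}` by removing the `i`-th bit from all labels. The
two smallest sets among the `E_i`-s have size at most `2m/k` … and removing them gives a valid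
labeling with image `{0,…,d'/4−1}`."

## What is proved

* `CKSV2022.valiant_depth_reduction` — the labeling form with general parameters: if the edge set
  `E` has a valid labeling with labels `< 2^k` and `r ≤ k`, then there is `E' ⊆ E` with
  `k·|E'| ≤ r·|E|` (the `r` smallest bit classes) such that `E ∖ E'` has a valid labeling with labels
  `< 2^(k−r)`. The printed instance is `r = 2` (`valiant_depth_reduction_two`: `k·|E'| ≤ 2·|E|`,
  new labels `< 2^(k−2) = d'/4`); the numerical dressing `d ≥ √n ⇒ k ≥ (log n)/2 ⇒ 2m/k ≤ 4m/log n`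
  is not repeated here.
* `CKSV2022.pathLength_lt_of_validLabeling` — "if there is a valid labeling with image `{0,…,N−1}`
  then `depth(G) ≤ N`": every walk along edges of `E` has fewer than `N` vertices (at most `N − 1`
  edges).

Rendering of the bit manipulation: labels `< 2^k` are read as bit vectors `Fin k → Bool`
(`CKSV2022.bitsOf`); an edge is in class `i` when its endpoint labels are *decided at* bit `i`
(`CKSV2022.DecidedAt`: equal above `i`, `0/1` at `i` — "the most significant bit in which the binary
encoding[s] … differ is `i`", `CKSV2022.exists_decidedAt_of_lt`); "removing the `i`-th bit" is
rendered as clearing the bits of the removed classes (`CKSV2022.clearBits`,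
`CKSV2022.DecidedAt.clearBits`), after which the labels range over the `2^(k−r)` vectors vanishing
on those bits and are re-packed into `{0, …, 2^(k−r)−1}` by rank (`CKSV2022.rank_lt_rank`,
`CKSV2022.rank_lt_card`). The counting step "the `r` smallest sets among the `E_i` have size at most
`r·m/k`" is `CKSV2022.exists_small_classes`.

D-0026: no named facts; everything is a definition with a body or a theorem.

## References
* [ChatterjeeKumarSheVolk2022] P. Chatterjee, M. Kumar, A. She, B. L. Volk, comput. complex. 31
  (2022) 8, doi:10.1007/s00037-022-00223-8, arXiv:1911.11793 — §4, Lemma 16 and its proof.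
* [Valiant1977] L. G. Valiant, Graph-theoretic arguments in low-level complexity, MFCS 1977,
  LNCS 53, pp. 162–176 — the original lemma.
-/

namespace Literature.Computability.AlgebraicComplexity

namespace CKSV2022

/-! ### Valid labelings and walks -/

section Labeling

variable {V : Type*}

/-- **Valid labeling** (CKSV Lemma 16, proof: "a function `f : V → {0,…,N−1}` such that whenever
`(u,v)` is an edge, `f(u) < f(v)`"); the range bound is kept as a separate hypothesis.
[cite: ChatterjeeKumarSheVolk2022, Lemma 16 (proof)] -/
def IsValidLabeling (E : Finset (V × V)) (f : V → ℕ) : Prop := ∀ e ∈ E, f e.1 < f e.2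

/-- A valid labeling of `E` is a valid labeling of every smaller edge set.
[cite: ChatterjeeKumarSheVolk2022, Lemma 16 (proof)] -/
theorem IsValidLabeling.mono {E E' : Finset (V × V)} (h : E' ⊆ E) {f : V → ℕ}
    (hf : IsValidLabeling E f) : IsValidLabeling E' f := fun e he => hf e (h he)

/-- "If there is a valid labeling with image `{0,…,N−1}` then `depth(G) ≤ N`" (Lemma 16, proof):
along a walk `v₀ → v₁ → ⋯` whose consecutive pairs are edges of `E` the labels increase strictly, so
a walk with all labels `< N` has fewer than `N` vertices, i.e. at most `N − 1` edges (`p ≠ []`).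
[cite: ChatterjeeKumarSheVolk2022, Lemma 16 (proof)] -/
theorem pathLength_lt_of_validLabeling {E : Finset (V × V)} {f : V → ℕ} (hf : IsValidLabeling E f)
    {N : ℕ} (hN : ∀ v, f v < N) :
    ∀ (p : List V), p ≠ [] → List.IsChain (fun u v => (u, v) ∈ E) p → p.length ≤ N := by
  -- the head label plus the number of later vertices stays below `N`
  suffices h : ∀ (p : List V) (v : V), List.IsChain (fun u v => (u, v) ∈ E) (v :: p) →
      f v + (v :: p).length ≤ N by
    intro p hp hc
    obtain ⟨v, q, rfl⟩ := List.exists_cons_of_ne_nil hp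
    have := h q v hc
    omega
  intro p
  induction p with
  | nil => intro v _; have := hN v; simp; omega
  | cons w q ih =>
    intro v hc
    have hvw : (v, w) ∈ E := (List.isChain_cons_cons.1 hc).1
    have hc' : List.IsChain (fun u v => (u, v) ∈ E) (w :: q) := (List.isChain_cons_cons.1 hc).2
    have h1 := ih w hc'
    have h2 : f v < f w := hf _ hvw
    simp only [List.length_cons] at h1 ⊢
    omega

end Labeling

/-! ### Bit vectors: the most significant differing bit, and clearing bits -/

section Bits

variable {k : ℕ}

/-- The binary encoding of a label, as a bit vector of length `k` ("the binary encoding of the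
labels", Lemma 16, proof). [cite: ChatterjeeKumarSheVolk2022, Lemma 16 (proof)] -/
def bitsOf (k : ℕ) (n : ℕ) : Fin k → Bool := fun j => n.testBit j

/-- `x` and `y` are **decided at bit `i`**: they agree above `i`, and at `i` the first has `0`, the
second `1` — "the most significant bit in which the binary encoding[s] … differ is `i`" together with
the comparison `x < y`. [cite: ChatterjeeKumarSheVolk2022, Lemma 16 (proof)] -/
def DecidedAt (x y : Fin k → Bool) (i : Fin k) : Prop :=
  x i = false ∧ y i = true ∧ ∀ j, i < j → x j = y j

/-- The deciding bit is unique. [cite: ChatterjeeKumarSheVolk2022, Lemma 16 (proof)] -/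
theorem DecidedAt.unique {x y : Fin k → Bool} {i i' : Fin k} (h : DecidedAt x y i)
    (h' : DecidedAt x y i') : i = i' := by
  rcases lt_trichotomy i i' with hlt | heq | hgt
  · have := h.2.2 i' hlt; rw [h'.1, h'.2.1] at this; exact absurd this (by decide)
  · exact heq
  · have := h'.2.2 i hgt; rw [h.1, h.2.1] at this; exact absurd this (by decide)

/-- No vector is decided against itself. [cite: ChatterjeeKumarSheVolk2022, Lemma 16 (proof)] -/
theorem DecidedAt.irrefl {x : Fin k → Bool} {i : Fin k} (h : DecidedAt x x i) : False := by
  have h1 := h.1; rw [h.2.1] at h1; exact absurd h1 (by decide)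

/-- Transitivity of "decided at some bit" (the comparison of binary encodings is transitive).
[cite: ChatterjeeKumarSheVolk2022, Lemma 16 (proof)] -/
theorem DecidedAt.trans {x y z : Fin k → Bool} {i i' : Fin k} (h : DecidedAt x y i)
    (h' : DecidedAt y z i') : ∃ i'', DecidedAt x z i'' := by
  rcases lt_trichotomy i i' with hlt | heq | hgt
  · refine ⟨i', ?_, h'.2.1, fun j hj => (h.2.2 j (hlt.trans hj)).trans (h'.2.2 j hj)⟩
    rw [h.2.2 i' hlt]; exact h'.1
  · subst heq
    have h1 := h.2.1; rw [h'.1] at h1; exact absurd h1 (by decide)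
  · refine ⟨i, h.1, ?_, fun j hj => (h.2.2 j hj).trans (h'.2.2 j (hgt.trans hj))⟩
    rw [← h'.2.2 i hgt]; exact h.2.1

/-- **Binary comparison**: if `x < y < 2^k` then the encodings of `x` and `y` are decided at the most
significant bit in which they differ. [cite: ChatterjeeKumarSheVolk2022, Lemma 16 (proof)] -/
theorem exists_decidedAt_of_lt {x y : ℕ} (hxy : x < y) (hy : y < 2 ^ k) :
    ∃ i : Fin k, DecidedAt (bitsOf k x) (bitsOf k y) i := by
  have hx : x < 2 ^ k := hxy.trans hy
  have hz : x ^^^ y ≠ 0 := fun h => (Nat.ne_of_lt hxy) (Nat.xor_eq_zero_iff.1 h)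
  obtain ⟨i, hi, habove⟩ := Nat.exists_most_significant_bit hz
  have hik : i < k := by
    have h1 : 2 ^ i ≤ x ^^^ y := Nat.ge_two_pow_of_testBit hi
    have h2 : x ^^^ y < 2 ^ k := Nat.xor_lt_two_pow hx hy
    exact (Nat.pow_lt_pow_iff_right Nat.one_lt_two).1 (h1.trans_lt h2)
  rw [Nat.testBit_xor] at hi
  have habove' : ∀ j, i < j → x.testBit j = y.testBit j := by
    intro j hj
    have := habove j hj
    rw [Nat.testBit_xor] at this
    revert this
    cases x.testBit j <;> cases y.testBit j <;> simp
  -- at bit `i` the smaller number has `0`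
  have hxi : x.testBit i = false := by
    by_contra hxt
    rw [Bool.not_eq_false] at hxt
    have hyt : y.testBit i = false := by
      revert hi; rw [hxt]; cases y.testBit i <;> simp
    exact absurd (Nat.lt_of_testBit i hyt hxt fun j hj => (habove' j hj).symm) (Nat.lt_asymm hxy)
  have hyi : y.testBit i = true := by
    revert hi; rw [hxi]; cases y.testBit i <;> simp
  exact ⟨⟨i, hik⟩, hxi, hyi, fun j hj => habove' j hj⟩

/-- **"Removing the `i`-th bit from all labels"**, rendered as clearing the bits in `B`.
[cite: ChatterjeeKumarSheVolk2022, Lemma 16 (proof)] -/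
def clearBits (B : Finset (Fin k)) (x : Fin k → Bool) : Fin k → Bool :=
  fun j => if j ∈ B then false else x j

/-- Clearing bits other than the deciding one keeps the comparison ("If `E_i` is removed, we can
obtain a valid relabeling … by removing the `i`-th bit from all labels").
[cite: ChatterjeeKumarSheVolk2022, Lemma 16 (proof)] -/
theorem DecidedAt.clearBits {x y : Fin k → Bool} {i : Fin k} (h : DecidedAt x y i)
    {B : Finset (Fin k)} (hi : i ∉ B) : DecidedAt (clearBits B x) (clearBits B y) i := by
  refine ⟨by rw [CKSV2022.clearBits, if_neg hi, h.1], by rw [CKSV2022.clearBits, if_neg hi, h.2.1],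
    fun j hj => ?_⟩
  simp only [CKSV2022.clearBits]
  split_ifs
  · rfl
  · exact h.2.2 j hj

/-- Cleared vectors vanish on the cleared bits. [cite: ChatterjeeKumarSheVolk2022, Lemma 16 (proof)] -/
theorem clearBits_apply_of_mem (B : Finset (Fin k)) (x : Fin k → Bool) {j : Fin k} (hj : j ∈ B) :
    clearBits B x j = false := by
  rw [clearBits, if_pos hj]

/-- The vectors vanishing on `B` number at most `2^(k − |B|)` ("a valid labeling with image
`{0, …, d'/2−1}`" after one bit, `d'/4` after two). [cite: ChatterjeeKumarSheVolk2022, Lemma 16 (proof)] -/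
theorem card_filter_vanishing_le (B : Finset (Fin k)) :
    (Finset.univ.filter fun x : Fin k → Bool => ∀ j ∈ B, x j = false).card ≤ 2 ^ (k - B.card) := by
  classical
  -- restrict to the coordinates outside `B`: injective on the vectors vanishing on `B`
  have hsub : Fintype.card {j : Fin k // j ∉ B} = k - B.card := by
    rw [Fintype.card_subtype_compl, Fintype.card_fin, Fintype.card_coe]
  have hcard : Fintype.card ({j : Fin k // j ∉ B} → Bool) = 2 ^ (k - B.card) := by
    rw [Fintype.card_fun, Fintype.card_bool, hsub]
  rw [← hcard, ← Finset.card_univ]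
  refine Finset.card_le_card_of_injOn (fun x => fun j : {j : Fin k // j ∉ B} => x j.1)
    (fun _ _ => Finset.mem_univ _) ?_
  intro x hx y hy hxy
  rw [Finset.mem_coe, Finset.mem_filter] at hx hy
  funext j
  by_cases hj : j ∈ B
  · rw [hx.2 j hj, hy.2 j hj]
  · exact congrFun hxy ⟨j, hj⟩

end Bits

/-! ### Re-packing labels by rank -/

section Rank

variable {α : Type*}

/-- The rank of `a` inside `F` for a relation `R`: the number of `R`-predecessors in `F` (re-packs an
`R`-increasing labeling with values in `F` into `{0, …, |F| − 1}`).
[cite: ChatterjeeKumarSheVolk2022, Lemma 16 (proof)] -/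
def rank (F : Finset α) (R : α → α → Prop) [DecidableRel R] (a : α) : ℕ := (F.filter fun x => R x a).card

/-- Rank is strictly monotone along `R` on `F` for a transitive irreflexive `R`.
[cite: ChatterjeeKumarSheVolk2022, Lemma 16 (proof)] -/
theorem rank_lt_rank (F : Finset α) (R : α → α → Prop) [DecidableRel R]
    (htrans : ∀ a b c, R a b → R b c → R a c) (hirr : ∀ a, ¬ R a a) {a b : α} (ha : a ∈ F)
    (hab : R a b) : rank F R a < rank F R b := by
  refine Finset.card_lt_card ⟨fun x hx => ?_, fun h => ?_⟩
  · rw [Finset.mem_filter] at hx ⊢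
    exact ⟨hx.1, htrans _ _ _ hx.2 hab⟩
  · have := h (Finset.mem_filter.2 ⟨ha, hab⟩)
    exact hirr a (Finset.mem_filter.1 this).2

/-- Rank is below `|F|` for elements of `F` (irreflexive `R`).
[cite: ChatterjeeKumarSheVolk2022, Lemma 16 (proof)] -/
theorem rank_lt_card (F : Finset α) (R : α → α → Prop) [DecidableRel R] (hirr : ∀ a, ¬ R a a)
    {a : α} (ha : a ∈ F) : rank F R a < F.card := by
  refine Finset.card_lt_card ⟨Finset.filter_subset _ _, fun h => ?_⟩
  exact hirr a (Finset.mem_filter.1 (h ha)).2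

end Rank

/-! ### The `r` smallest classes -/

section Smallest

variable {ι : Type*} [Fintype ι] [DecidableEq ι]

/-- A threshold set of every size: `r` indices whose values are no larger than any value outside.
[cite: ChatterjeeKumarSheVolk2022, Lemma 16 (proof)] -/
theorem exists_threshold_set (c : ι → ℕ) :
    ∀ r, r ≤ Fintype.card ι → ∃ B : Finset ι, B.card = r ∧ ∀ i ∈ B, ∀ j, j ∉ B → c i ≤ c j := by
  intro r
  induction r with
  | zero => intro _; exact ⟨∅, rfl, fun i hi => absurd hi (Finset.notMem_empty i)⟩
  | succ r ih =>
    intro hr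
    obtain ⟨B, hB, hthr⟩ := ih (by omega)
    have hne : (Finset.univ \ B).Nonempty := by
      rw [Finset.nonempty_iff_ne_empty, Ne, Finset.sdiff_eq_empty_iff_subset]
      intro h
      have := Finset.card_le_card h
      rw [Finset.card_univ, hB] at this
      omega
    obtain ⟨j₀, hj₀, hmin⟩ := Finset.exists_min_image _ c hne
    have hj₀B : j₀ ∉ B := (Finset.mem_sdiff.1 hj₀).2
    refine ⟨insert j₀ B, by rw [Finset.card_insert_of_notMem hj₀B, hB], fun i hi j hj => ?_⟩
    rw [Finset.mem_insert, not_or] at hj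
    rcases Finset.mem_insert.1 hi with rfl | hi
    · exact hmin j (Finset.mem_sdiff.2 ⟨Finset.mem_univ _, hj.2⟩)
    · exact hthr i hi j hj.2

/-- **"The `r` smallest sets among the `E_i`-s have size at most `r·m/k`"** (Lemma 16, proof, with
`r = 2`: "at most `2m/k`"): for sizes `c : ι → ℕ` there are `r ≤ |ι|` indices whose total is at most
the average share, `|ι| · Σ_{i ∈ B} c_i ≤ r · Σ_i c_i`. [cite: ChatterjeeKumarSheVolk2022, Lemma 16 (proof)] -/
theorem exists_small_classes (c : ι → ℕ) {r : ℕ} (hr : r ≤ Fintype.card ι) :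
    ∃ B : Finset ι, B.card = r ∧ Fintype.card ι * ∑ i ∈ B, c i ≤ r * ∑ i, c i := by
  obtain ⟨B, hB, hthr⟩ := exists_threshold_set c r hr
  refine ⟨B, hB, ?_⟩
  set A := ∑ i ∈ B, c i with hA
  -- `A ≤ r · c_j` for every `j ∉ B`
  have hAj : ∀ j, j ∉ B → A ≤ r * c j := fun j hj =>
    calc A ≤ ∑ _i ∈ B, c j := Finset.sum_le_sum fun i hi => hthr i hi j hj
      _ = r * c j := by rw [Finset.sum_const_nat fun _ _ => rfl, hB]
  -- sum over the complement
  have hsum : ∑ i, c i = A + ∑ j ∈ Finset.univ \ B, c j := by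
    rw [hA, ← Finset.sum_union Finset.disjoint_sdiff, Finset.union_sdiff_of_subset (Finset.subset_univ B)]
  have hcompl : (Finset.univ \ B).card = Fintype.card ι - r := by
    rw [Finset.card_univ_sdiff, hB]
  have h1 : (Fintype.card ι - r) * A ≤ r * ∑ j ∈ Finset.univ \ B, c j :=
    calc (Fintype.card ι - r) * A = ∑ _j ∈ Finset.univ \ B, A := by
          rw [Finset.sum_const_nat fun _ _ => rfl, hcompl]
      _ ≤ ∑ j ∈ Finset.univ \ B, r * c j :=
          Finset.sum_le_sum fun j hj => hAj j (Finset.mem_sdiff.1 hj).2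
      _ = r * ∑ j ∈ Finset.univ \ B, c j := by rw [Finset.mul_sum]
  rw [hsum, Nat.mul_add]
  have h2 : Fintype.card ι * A = (Fintype.card ι - r) * A + r * A := by
    rw [← Nat.add_mul, Nat.sub_add_cancel hr]
  rw [h2]
  omega

end Smallest

/-! ### Valiant's lemma -/

section Main

variable {V : Type*} [DecidableEq V]

open Classical in
/-- **Valiant's depth-reduction lemma** (Valiant 1977; CKSV 2022 Lemma 16 with its printed proof),
labeling form, general parameters: if the edges `E` carry a valid labeling `f` with labels `< 2^k`
on the heads (hence on both endpoints) and `r ≤ k`, then there is a set `E' ⊆ E` of edges — the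
union of the `r` smallest of the `k` classes `E_i = {most significant differing bit is i}` — with
`k·|E'| ≤ r·|E|`, such that `E ∖ E'` has a valid labeling with all labels `< 2^(k−r)`.
[cite: ChatterjeeKumarSheVolk2022, Lemma 16] -/
theorem valiant_depth_reduction (E : Finset (V × V)) {k : ℕ} (f : V → ℕ) (hf : IsValidLabeling E f)
    (hk : ∀ e ∈ E, f e.2 < 2 ^ k) {r : ℕ} (hr : r ≤ k) :
    ∃ E' : Finset (V × V), E' ⊆ E ∧ k * E'.card ≤ r * E.card ∧
      ∃ g : V → ℕ, IsValidLabeling (E \ E') g ∧ ∀ v, g v < 2 ^ (k - r) := by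
  -- bit encodings and the classes `E_i`
  let β : V → Fin k → Bool := fun v => bitsOf k (f v)
  let cls : Fin k → Finset (V × V) := fun i => E.filter fun e => DecidedAt (β e.1) (β e.2) i
  have hex : ∀ e ∈ E, ∃ i, DecidedAt (β e.1) (β e.2) i := fun e he =>
    exists_decidedAt_of_lt (hf e he) (hk e he)
  -- the classes partition `E`
  have hpart : ∑ i, (cls i).card = E.card := by
    rw [← Finset.card_biUnion]
    · congr 1
      ext e
      simp only [Finset.mem_biUnion, Finset.mem_univ, true_and, cls, Finset.mem_filter]
      exact ⟨fun ⟨_, he, _⟩ => he, fun he => by obtain ⟨i, hi⟩ := hex e he; exact ⟨i, he, hi⟩⟩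
    · intro i _ j _ hij
      simp only [Function.onFun]
      rw [Finset.disjoint_left]
      intro e hei hej
      exact hij ((Finset.mem_filter.1 hei).2.unique (Finset.mem_filter.1 hej).2)
  -- the `r` smallest classes
  obtain ⟨B, hB, hsmall⟩ := exists_small_classes (fun i => (cls i).card) (r := r)
    (by rw [Fintype.card_fin]; exact hr)
  rw [Fintype.card_fin, hpart] at hsmall
  refine ⟨B.biUnion cls, ?_, ?_, ?_⟩
  · exact Finset.biUnion_subset.2 fun i _ => Finset.filter_subset _ _
  · exact (Nat.mul_le_mul_left k Finset.card_biUnion_le).trans hsmall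
  -- the new labeling: clear the bits in `B`, then rank within the vectors vanishing on `B`
  let F : Finset (Fin k → Bool) := Finset.univ.filter fun x => ∀ j ∈ B, x j = false
  let R : (Fin k → Bool) → (Fin k → Bool) → Prop := fun x y => ∃ i, DecidedAt x y i
  have htrans : ∀ a b c, R a b → R b c → R a c := fun a b c ⟨i, hi⟩ ⟨i', hi'⟩ => hi.trans hi'
  have hirr : ∀ a, ¬ R a a := fun a ⟨i, hi⟩ => hi.irrefl
  have hmemF : ∀ v, clearBits B (β v) ∈ F := fun v =>
    Finset.mem_filter.2 ⟨Finset.mem_univ _, fun j hj => clearBits_apply_of_mem B _ hj⟩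
  refine ⟨fun v => rank F R (clearBits B (β v)), fun e he => ?_, fun v => ?_⟩
  · -- an edge outside `E'` is decided at a bit outside `B`
    rw [Finset.mem_sdiff] at he
    obtain ⟨i, hi⟩ := hex e he.1
    have hiB : i ∉ B := fun hiB => he.2 (Finset.mem_biUnion.2 ⟨i, hiB, Finset.mem_filter.2 ⟨he.1, hi⟩⟩)
    exact rank_lt_rank F R htrans hirr (hmemF e.1) ⟨i, hi.clearBits hiB⟩
  · exact (rank_lt_card F R hirr (hmemF v)).trans_le (hB ▸ card_filter_vanishing_le B)

/-- **Lemma 16 as printed (two classes)**: with labels `< 2^k = d'`, removing the two smallest bit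
classes (`k·|E'| ≤ 2·|E|`, i.e. `|E'| ≤ 2m/k`) leaves a valid labeling with labels `< 2^(k−2) = d'/4`
("removing them gives a valid labeling with image `{0,…,d'/4−1}`, and therefore a graph with depth
at most `d'/4 ≤ d/2`"). [cite: ChatterjeeKumarSheVolk2022, Lemma 16] -/
theorem valiant_depth_reduction_two (E : Finset (V × V)) {k : ℕ} (hk2 : 2 ≤ k) (f : V → ℕ)
    (hf : IsValidLabeling E f) (hk : ∀ e ∈ E, f e.2 < 2 ^ k) :
    ∃ E' : Finset (V × V), E' ⊆ E ∧ k * E'.card ≤ 2 * E.card ∧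
      ∃ g : V → ℕ, IsValidLabeling (E \ E') g ∧ ∀ v, g v < 2 ^ (k - 2) :=
  valiant_depth_reduction E f hf hk hk2

end Main

/-! ### Depth is a valid labeling -/

section DepthLabel

variable {V : Type*}

open Classical in
/-- **Labeling by depth** ("if `G` had depth `d` then there is a valid labeling … by labeling each
vertex by its depth", Lemma 16, proof): the largest `ℓ ≤ D` such that some walk along edges of `E`
with `ℓ + 1` vertices ends at `v` (walks recorded backwards: `v :: q` with `(q₀, v), (q₁, q₀), … ∈ E`).
[cite: ChatterjeeKumarSheVolk2022, Lemma 16 (proof)] -/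
noncomputable def depthLabel (E : Finset (V × V)) (D : ℕ) (v : V) : ℕ :=
  Nat.findGreatest (fun ℓ => ∃ q : List V, List.IsChain (fun a b => (b, a) ∈ E) (v :: q) ∧ q.length = ℓ) D

/-- **"If `G` had depth `d` then there is a valid labeling with image `{0,…,d−1}` by labeling each
vertex by its depth"** (Lemma 16, proof; the converse of `pathLength_lt_of_validLabeling`): if every
walk along edges of `E` has at most `D` vertices, then `depthLabel E D` is a valid labeling with
all labels `< D`. [cite: ChatterjeeKumarSheVolk2022, Lemma 16 (proof)] -/
theorem isValidLabeling_depthLabel (E : Finset (V × V)) {D : ℕ}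
    (hD : ∀ p : List V, p ≠ [] → List.IsChain (fun u v => (u, v) ∈ E) p → p.length ≤ D) :
    IsValidLabeling E (depthLabel E D) ∧ ∀ v, depthLabel E D v < D := by
  classical
  -- a backward walk `v :: q` is a forward walk with `q.length + 1` vertices, so `q.length + 1 ≤ D`
  have hback : ∀ (v : V) (q : List V), List.IsChain (fun a b => (b, a) ∈ E) (v :: q) →
      q.length + 1 ≤ D := by
    intro v q hq
    have h1 := hD (v :: q).reverse (by simp) (List.isChain_reverse.2 hq)
    simpa using h1
  -- every label is attained by a walk, and is `≤ D − 1`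
  have hP0 : ∀ v : V, ∃ q : List V, List.IsChain (fun a b => (b, a) ∈ E) (v :: q) ∧ q.length = 0 :=
    fun v => ⟨[], List.isChain_singleton v, rfl⟩
  have hspec : ∀ v, ∃ q : List V, List.IsChain (fun a b => (b, a) ∈ E) (v :: q) ∧
      q.length = depthLabel E D v := fun v =>
    Nat.findGreatest_spec (P := fun ℓ => ∃ q : List V,
      List.IsChain (fun a b => (b, a) ∈ E) (v :: q) ∧ q.length = ℓ) (Nat.zero_le D) (hP0 v)
  have hlt : ∀ v, depthLabel E D v < D := by
    intro v
    obtain ⟨q, hq, hlen⟩ := hspec v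
    have := hback v q hq
    omega
  refine ⟨fun e he => ?_, hlt⟩
  -- extend a longest walk ending at the tail `e.1` by the edge `e`
  obtain ⟨q, hq, hlen⟩ := hspec e.1
  have hq' : List.IsChain (fun a b => (b, a) ∈ E) (e.2 :: e.1 :: q) :=
    List.isChain_cons_cons.2 ⟨by simpa using he, hq⟩
  have hlen' : (e.1 :: q).length = depthLabel E D e.1 + 1 := by rw [List.length_cons, hlen]
  have hle : depthLabel E D e.1 + 1 ≤ D := by have := hback e.2 (e.1 :: q) hq'; rw [hlen'] at this; omega
  exact Nat.lt_of_lt_of_le (Nat.lt_succ_self _)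
    (Nat.le_findGreatest (P := fun ℓ => ∃ q : List V,
      List.IsChain (fun a b => (b, a) ∈ E) (e.2 :: q) ∧ q.length = ℓ) hle ⟨e.1 :: q, hq', hlen'⟩)

/-- **The two halves of Lemma 16's preliminary together**: `E` admits a valid labeling with labels
`< D` iff every walk along its edges has at most `D` vertices ("depth `≤ D`" in the
labeling sense ⇔ in the path sense). [cite: ChatterjeeKumarSheVolk2022, Lemma 16 (proof)] -/
theorem exists_validLabeling_iff_pathLength_le (E : Finset (V × V)) (D : ℕ) :
    (∃ f : V → ℕ, IsValidLabeling E f ∧ ∀ v, f v < D) ↔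
      ∀ p : List V, p ≠ [] → List.IsChain (fun u v => (u, v) ∈ E) p → p.length ≤ D :=
  ⟨fun ⟨_, hf, hN⟩ => pathLength_lt_of_validLabeling hf hN,
    fun h => ⟨depthLabel E D, isValidLabeling_depthLabel E h⟩⟩

/-- **Lemma 16, depth to depth** (as printed: "Let `G` be a directed acyclic graph with `m` edges and
depth `d` … there exists a set `E'` of … edges such that removing `E'` from `G` results in a graph of
depth at most `d/2`", with `d ≤ d' = 2^k` "a smallest power of 2 larger than `d`"): if every walk
along `E` has at most `D ≤ 2^k` vertices and `r ≤ k`, then removing a set `E'` of edges with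
`k·|E'| ≤ r·|E|` leaves a graph all of whose walks have at most `2^(k−r)` vertices (`r = 2`:
`|E'| ≤ 2m/k`, depth `≤ d'/4 ≤ d/2`). Assembled from `isValidLabeling_depthLabel`,
`valiant_depth_reduction` and `pathLength_lt_of_validLabeling`.
[cite: ChatterjeeKumarSheVolk2022, Lemma 16] -/
theorem valiant_depth_reduction_paths [DecidableEq V] (E : Finset (V × V)) {k r D : ℕ}
    (hD : D ≤ 2 ^ k) (hr : r ≤ k)
    (hdepth : ∀ p : List V, p ≠ [] → List.IsChain (fun u v => (u, v) ∈ E) p → p.length ≤ D) :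
    ∃ E' : Finset (V × V), E' ⊆ E ∧ k * E'.card ≤ r * E.card ∧
      ∀ p : List V, p ≠ [] → List.IsChain (fun u v => (u, v) ∈ E \ E') p → p.length ≤ 2 ^ (k - r) := by
  obtain ⟨hval, hlt⟩ := isValidLabeling_depthLabel E hdepth
  obtain ⟨E', hE'E, hcard, g, hg, hgN⟩ := valiant_depth_reduction E (depthLabel E D) hval
    (fun e _ => (hlt e.2).trans_le hD) hr
  exact ⟨E', hE'E, hcard, pathLength_lt_of_validLabeling hg hgN⟩

end DepthLabel

end CKSV2022

end Literature.Computability.AlgebraicComplexity
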